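import Literature.Probability.Percolation.PercolationProofs
import Literature.Probability.LatticeModels.IsoradialPercolation
import HarnessLib

/-!
# The one-cut bound for at most three blobs: the minority event is a single pair cut

Support file for the crux `NoHeavyLowerTail` (stmt-CriticalPhenomena-4575; routes `PercNearOneGluing`,
`PercNearOneGluingNoHeavy`), BLOB-QUOTIENT analysis of the one-cut engine (depth prover nh-dp-blobmono).

The typed open kernel of `Theorems.noHeavyLowerTail_of_oneCut` is the ONE-CUT BOUND: for bond percolation
`μ = prodBernoulli w` with arbitrary edge probabilities on `Fin n`, a relay set `A`, an observer `o`, and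
`t ≥ 0` bounding every pairwise disconnection probability among distinct relays,
`μ{1 ≤ N ∧ N < E N / 2} ≤ t`, where `N = |{a ∈ A : o ↔ a}|` and `E N = Σ_{a ∈ A} μ(o ↔ a)`.

A BLOB STRUCTURE with `b` blobs is a labelling `cls : Fin n → Fin b` such that any two points of
`insert o A` with the same label are joined almost surely (`μ{u ↮ v} = 0`) — e.g. the classes of the
relation "joined by a path of weight-1 edges" when there are at most `b` of them on `insert o A`; the
quotient picture of the route's census (ttrl, kit j028329: b ≤ 5 blobs, |A| ≤ 10, 0 violations, equality
attained) is exactly this with the blobs contracted.  This file PROVES the bound for every blob structure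
with at most THREE blobs and every `|A|` (`oneCut_of_threeBlobs`), by showing that the minority event is
then, up to a null set, contained in ONE pair cut `{x ↮ y}` for a fixed pair of distinct relays `x, y`
chosen from the blob masses `m_i = |A ∩ cls⁻¹ i|` alone:

* `E N ≤ |A|`, so the threshold `T = E N/2` is at most half the total mass, and among the two blobs other
  than the observer's blob `i₀ = cls o` at least one, `k`, is HEAVY: `m_{i₀} + m_k ≥ T`
  (`exists_heavy_blob`); on the good set, `o ↔ (any relay of blob k)` forces `N ≥ m_{i₀} + m_k ≥ T`
  (`blobs_count_ge`), so the minority event misses blob `k`;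
* if the observer's blob carries a relay `x`, the cut is `{x ↮ y}` with `y` any relay of blob `k`;
* if it carries none, some blob `k` alone has `m_k ≥ T`, the minority event (which has `N ≥ 1`) meets the
  third blob `j` and misses `k`, and the cut is `{x ↮ y}` with `x ∈ A ∩ blob j`, `y ∈ A ∩ blob k`
  (degenerate sub-cases give the empty event).

So for ≤ 3 blobs the one-cut bound is pure logic plus `μ(o ↔ a) ≤ 1` — no correlation inequality is used,
and the two-blob template of `Theorems/NoHeavyLowerTail/Negative/LinearFormTight.lean` shows it is attained.
The first configuration that is NOT an `ω`-wise single cut has four blobs `{o}, {a}, {b}, {c}`; there the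
bound needs the tripod exchange inequality C⁺ (`Theorems.lonelyRelay_three`, `Theorems.oneCut_card_le_three`,
`Theorems.twoCutMaster_le`).  What remains for four blobs in general is recorded in the crux notes
(sub-case R4a: observer blob with relays and three light blobs, `{|S| ≤ 1}` under `Σ_k m_k μ(o ↔ a_k) >
m_{i₀} + 2 max_k m_k`); five or more blobs is the general one-cut bound.
-/

noncomputable section

namespace Summit.CriticalPhenomena.PercolationContinuityZ3.Theorems

open MeasureTheory Literature.Probability.LatticeModels Literature.Probability.Percolation
open scoped Classical BigOperators

variable {n : ℕ}

/-- On the good set of a blob structure (same label on `insert o A` ⇒ joined), if `o` reaches a relay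
`y` whose blob is not the observer's, then every relay of the observer's blob and of `y`'s blob is
counted: `m_{i₀} + m_{cls y} ≤ N`. [folklore] -/
theorem blobs_count_ge {b : ℕ} (A : Finset (Fin n)) (o : Fin n) (cls : Fin n → Fin b)
    (ω : BondConfig (Fin n))
    (hω : ∀ u ∈ insert o A, ∀ v ∈ insert o A, cls u = cls v → (openGraph ω).Reachable u v)
    {y : Fin n} (hy : y ∈ A) (hoy : (openGraph ω).Reachable o y) (hk : cls y ≠ cls o) :
    (A.filter fun a => cls a = cls o).card + (A.filter fun a => cls a = cls y).card ≤
      (A.filter fun a => ω ∈ openConn o a).card := by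
  classical
  rw [← Finset.card_union_of_disjoint
    (Finset.disjoint_filter.2 fun a _ h1 h2 => hk (h2.symm.trans h1))]
  apply Finset.card_le_card
  intro a ha
  simp only [Finset.mem_union, Finset.mem_filter] at ha ⊢
  rcases ha with ⟨haA, hca⟩ | ⟨haA, hca⟩
  · exact ⟨haA, hω o (Finset.mem_insert_self _ _) a (Finset.mem_insert_of_mem haA) hca.symm⟩
  · exact ⟨haA, hoy.trans
      (hω y (Finset.mem_insert_of_mem hy) a (Finset.mem_insert_of_mem haA) hca.symm)⟩

/-- On the good set every relay of the observer's blob is counted: `m_{i₀} ≤ N`. [folklore] -/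
theorem blobs_count_ge_self {b : ℕ} (A : Finset (Fin n)) (o : Fin n) (cls : Fin n → Fin b)
    (ω : BondConfig (Fin n))
    (hω : ∀ u ∈ insert o A, ∀ v ∈ insert o A, cls u = cls v → (openGraph ω).Reachable u v) :
    (A.filter fun a => cls a = cls o).card ≤ (A.filter fun a => ω ∈ openConn o a).card := by
  classical
  apply Finset.card_le_card
  intro a ha
  simp only [Finset.mem_filter] at ha ⊢
  exact ⟨ha.1, hω o (Finset.mem_insert_self _ _) a (Finset.mem_insert_of_mem ha.1) ha.2.symm⟩

/-- The total mass splits over the blobs: `|A| = Σ_i m_i`. [folklore] -/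
theorem blobs_card_eq_sum {b : ℕ} (A : Finset (Fin n)) (cls : Fin n → Fin b) :
    (A.card : ℝ) = ∑ i : Fin b, ((A.filter fun a => cls a = i).card : ℝ) := by
  classical
  rw [Finset.card_eq_sum_card_fiberwise (t := Finset.univ) (f := cls) fun a _ => Finset.mem_univ _]
  push_cast
  rfl

/-- `E N = Σ_{a ∈ A} μ(o ↔ a) ≤ |A|`. [folklore] -/
theorem expectedCount_le_card (w : Sym2 (Fin n) → unitInterval) (A : Finset (Fin n)) (o : Fin n) :
    (∑ a ∈ A, (prodBernoulli w).real (openConn o a)) ≤ (A.card : ℝ) := by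
  calc (∑ a ∈ A, (prodBernoulli w).real (openConn o a)) ≤ ∑ _a ∈ A, (1 : ℝ) :=
        Finset.sum_le_sum fun a _ => measureReal_le_one
    _ = (A.card : ℝ) := by simp

/-- **Heavy blob.**  With three blobs, for any threshold `T ≤ |A|/2` some blob `k` other than the
observer's blob `i₀` has `m_{i₀} + m_k ≥ T` (the two other blobs cannot both be light, since
`2 m_{i₀} + m_j + m_k < 2T ≤ |A| = m_{i₀} + m_j + m_k` is absurd). [folklore] -/
theorem exists_heavy_blob (A : Finset (Fin n)) (cls : Fin n → Fin 3) (i₀ : Fin 3) (T : ℝ)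
    (hT : T ≤ (A.card : ℝ) / 2) :
    ∃ k : Fin 3, k ≠ i₀ ∧
      T ≤ ((A.filter fun a => cls a = i₀).card : ℝ) + ((A.filter fun a => cls a = k).card : ℝ) := by
  classical
  by_contra h
  push Not at h
  set m : Fin 3 → ℝ := fun i => ((A.filter fun a => cls a = i).card : ℝ) with hm
  have hsum : (A.card : ℝ) = m i₀ + ∑ k ∈ Finset.univ.erase i₀, m k := by
    rw [blobs_card_eq_sum A cls, ← Finset.add_sum_erase Finset.univ m (Finset.mem_univ i₀)]
  have hne : (Finset.univ.erase i₀ : Finset (Fin 3)).Nonempty := by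
    rw [← Finset.card_pos, Finset.card_erase_of_mem (Finset.mem_univ _), Finset.card_univ,
      Fintype.card_fin]
    norm_num
  have hcard : ((Finset.univ.erase i₀ : Finset (Fin 3)).card : ℝ) = 2 := by
    rw [Finset.card_erase_of_mem (Finset.mem_univ _), Finset.card_univ, Fintype.card_fin]
    norm_num
  have hlt : ∑ k ∈ Finset.univ.erase i₀, (m i₀ + m k) < ∑ _k ∈ Finset.univ.erase i₀, T :=
    Finset.sum_lt_sum_of_nonempty hne fun k hk => h k (Finset.ne_of_mem_erase hk)
  rw [Finset.sum_add_distrib, Finset.sum_const, Finset.sum_const, nsmul_eq_mul, nsmul_eq_mul,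
    hcard] at hlt
  have hm0 : 0 ≤ m i₀ := Nat.cast_nonneg _
  linarith

/-- **The one-cut bound for at most three blobs (blob-quotient census b ≤ 3, every `|A|`, every
weight), unconditional.**  Same binder shape as the hypothesis of `Theorems.noHeavyLowerTail_of_oneCut`,
plus a blob structure `cls : Fin n → Fin 3` on `insert o A` (same label ⇒ joined almost surely).  Then
`μ{1 ≤ N ∧ N < E N/2} ≤ t` whenever all pairwise disconnection probabilities among distinct relays are
`≤ t`; in fact the minority event lies, up to a null set, in a single cut `{x ↮ y}`.  Pure logic plus
`E N ≤ |A|`; no correlation inequality is used (contrast: four singleton blobs need C⁺,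
`Theorems.oneCut_card_le_three`). [folklore] -/
theorem oneCut_of_threeBlobs :
    ∀ (n : ℕ) (w : Sym2 (Fin n) → unitInterval) (A : Finset (Fin n)) (o : Fin n) (t : ℝ)
      (cls : Fin n → Fin 3),
      (∀ u ∈ insert o A, ∀ v ∈ insert o A, cls u = cls v →
        (Literature.Probability.LatticeModels.prodBernoulli w).real
          (Literature.Probability.Percolation.openConn u v)ᶜ = 0) →
      0 ≤ t →
      (∀ a ∈ A, ∀ a' ∈ A, a ≠ a' →
        (Literature.Probability.LatticeModels.prodBernoulli w).real
          (Literature.Probability.Percolation.openConn a a')ᶜ ≤ t) →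
      (Literature.Probability.LatticeModels.prodBernoulli w).real
        {ω : Literature.Probability.Percolation.BondConfig (Fin n) |
          1 ≤ (A.filter fun a => ω ∈ Literature.Probability.Percolation.openConn o a).card ∧
          ((A.filter fun a => ω ∈ Literature.Probability.Percolation.openConn o a).card : ℝ) <
            (∑ a ∈ A, (Literature.Probability.LatticeModels.prodBernoulli w).real
              (Literature.Probability.Percolation.openConn o a)) / 2} ≤ t := by
  intro n w A o t cls hcls ht hpair
  classical
  set μ := prodBernoulli w with hμ
  set EN := ∑ a ∈ A, μ.real (openConn o a) with hEN
  set B := {ω : BondConfig (Fin n) | 1 ≤ (A.filter fun a => ω ∈ openConn o a).card ∧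
      ((A.filter fun a => ω ∈ openConn o a).card : ℝ) < EN / 2} with hB
  set G := {ω : BondConfig (Fin n) | ∀ u ∈ insert o A, ∀ v ∈ insert o A, cls u = cls v →
      (openGraph ω).Reachable u v} with hG
  -- the good set has full measure
  have hGc : μ.real Gᶜ = 0 := by
    apply le_antisymm _ measureReal_nonneg
    have hsub : Gᶜ ⊆ ⋃ u ∈ insert o A, ⋃ v ∈ insert o A,
        {ω : BondConfig (Fin n) | cls u = cls v ∧ ω ∉ openConn u v} := by
      intro ω hω
      simp only [hG, Set.mem_compl_iff, Set.mem_setOf_eq, not_forall] at hω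
      obtain ⟨u, hu, v, hv, huv, hnot⟩ := hω
      simp only [Set.mem_iUnion, Set.mem_setOf_eq]
      exact ⟨u, hu, v, hv, huv, hnot⟩
    calc μ.real Gᶜ
        ≤ μ.real (⋃ u ∈ insert o A, ⋃ v ∈ insert o A,
            {ω : BondConfig (Fin n) | cls u = cls v ∧ ω ∉ openConn u v}) :=
          measureReal_mono hsub (measure_ne_top _ _)
      _ ≤ ∑ u ∈ insert o A, μ.real (⋃ v ∈ insert o A,
            {ω : BondConfig (Fin n) | cls u = cls v ∧ ω ∉ openConn u v}) :=
          measureReal_biUnion_finset_le _ _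
      _ ≤ ∑ u ∈ insert o A, ∑ v ∈ insert o A,
            μ.real {ω : BondConfig (Fin n) | cls u = cls v ∧ ω ∉ openConn u v} :=
          Finset.sum_le_sum fun u _ => measureReal_biUnion_finset_le _ _
      _ = 0 := Finset.sum_eq_zero fun u hu => Finset.sum_eq_zero fun v hv => by
          by_cases huv : cls u = cls v
          · have e : {ω : BondConfig (Fin n) | cls u = cls v ∧ ω ∉ openConn u v} = (openConn u v)ᶜ := by
              ext ω; simp [huv]
            rw [e]
            exact hcls u hu v hv huv
          · have e : {ω : BondConfig (Fin n) | cls u = cls v ∧ ω ∉ openConn u v} = ∅ := by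
              ext ω; simp [huv]
            rw [e, measureReal_empty]
  -- it suffices to trap `B ∩ G` in an event of mass `≤ t`
  suffices key : ∃ E : Set (BondConfig (Fin n)), B ∩ G ⊆ E ∧ μ.real E ≤ t by
    obtain ⟨E, hBE, hE⟩ := key
    calc μ.real B ≤ μ.real (B ∩ G ∪ Gᶜ) := measureReal_mono fun ω hω => by
            by_cases hωG : ω ∈ G
            · exact Or.inl ⟨hω, hωG⟩
            · exact Or.inr hωG
      _ ≤ μ.real (B ∩ G) + μ.real Gᶜ := measureReal_union_le _ _
      _ ≤ μ.real E + 0 := by rw [hGc]; exact add_le_add_left (measureReal_mono hBE) _  -- placeholder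
      _ ≤ t := by linarith
  -- the threshold is at most half the total mass
  have hT : EN / 2 ≤ (A.card : ℝ) / 2 := by
    have := expectedCount_le_card w A o
    linarith
  -- unpacking membership in `B ∩ G`
  have memB : ∀ ω, ω ∈ B ∩ G → 1 ≤ (A.filter fun a => ω ∈ openConn o a).card ∧
      ((A.filter fun a => ω ∈ openConn o a).card : ℝ) < EN / 2 ∧
      (∀ u ∈ insert o A, ∀ v ∈ insert o A, cls u = cls v → (openGraph ω).Reachable u v) :=
    fun ω hω => ⟨hω.1.1, hω.1.2, hω.2⟩
  by_cases h0 : (A.filter fun a => cls a = cls o).card = 0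
  · -- Case B: the observer's blob carries no relay
    -- some other blob alone is heavy
    obtain ⟨k, hki, hk⟩ := exists_heavy_blob A cls (cls o) (EN / 2) hT
    have hk' : EN / 2 ≤ ((A.filter fun a => cls a = k).card : ℝ) := by
      have : ((A.filter fun a => cls a = cls o).card : ℝ) = 0 := by exact_mod_cast h0
      simpa [this] using hk
    -- no relay has the observer's label
    have hnot0 : ∀ a ∈ A, cls a ≠ cls o := fun a ha hca =>
      Finset.card_ne_zero_of_mem (Finset.mem_filter.2 ⟨ha, hca⟩) h0
    -- on `B ∩ G`, no relay of blob `k` is reached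
    have hmiss : ∀ ω, ω ∈ B ∩ G → ∀ y ∈ A, cls y = k → ¬ (openGraph ω).Reachable o y := by
      intro ω hω y hy hcy hoy
      obtain ⟨_, hlt, hωG⟩ := memB ω hω
      have hge := blobs_count_ge A o cls ω hωG hy hoy (by rw [hcy]; exact hki)
      have hge' : ((A.filter fun a => cls a = cls o).card : ℝ) +
          ((A.filter fun a => cls a = k).card : ℝ) ≤
            ((A.filter fun a => ω ∈ openConn o a).card : ℝ) := by
        rw [← hcy]; exact_mod_cast hge
      have hm0 : (0 : ℝ) ≤ ((A.filter fun a => cls a = cls o).card : ℝ) := Nat.cast_nonneg _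
      linarith
    by_cases hthird : ∃ x ∈ A, cls x ≠ k
    · obtain ⟨x, hx, hxk⟩ := hthird
      by_cases hmk : (A.filter fun a => cls a = k).card = 0
      · -- then `EN/2 ≤ 0` and `B` is empty
        refine ⟨∅, fun ω hω => ?_, by rw [measureReal_empty]; exact ht⟩
        obtain ⟨h1, hlt, -⟩ := memB ω hω
        have : ((A.filter fun a => cls a = k).card : ℝ) = 0 := by exact_mod_cast hmk
        have h1' : (1 : ℝ) ≤ ((A.filter fun a => ω ∈ openConn o a).card : ℝ) := by exact_mod_cast h1
        linarith
      · obtain ⟨y, hy⟩ := Finset.card_pos.1 (Nat.pos_of_ne_zero hmk)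
        obtain ⟨hyA, hcy⟩ := Finset.mem_filter.1 hy
        have hxy : x ≠ y := fun h => hxk (by rw [h, hcy])
        refine ⟨(openConn x y)ᶜ, fun ω hω hxy' => ?_, hpair x hx y hyA hxy⟩
        obtain ⟨h1, hlt, hωG⟩ := memB ω hω
        -- some relay `a` is reached; it lies in the third blob, i.e. in `x`'s blob
        obtain ⟨a, ha⟩ := Finset.card_pos.1 h1
        obtain ⟨haA, hoa⟩ := Finset.mem_filter.1 ha
        have hca_k : cls a ≠ k := fun h => hmiss ω hω a haA h hoa
        have hca_x : cls a = cls x := by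
          have h1 := hnot0 a haA
          have h2 := hnot0 x hx
          omega
        have hax : (openGraph ω).Reachable a x :=
          hωG a (Finset.mem_insert_of_mem haA) x (Finset.mem_insert_of_mem hx) hca_x
        exact hmiss ω hω y hyA hcy ((hoa.trans hax).trans hxy')
    · -- every relay lies in blob `k`: the minority event is empty on `G`
      push Not at hthird
      refine ⟨∅, fun ω hω => ?_, by rw [measureReal_empty]; exact ht⟩
      obtain ⟨h1, -, -⟩ := memB ω hω
      obtain ⟨a, ha⟩ := Finset.card_pos.1 h1
      obtain ⟨haA, hoa⟩ := Finset.mem_filter.1 ha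
      exact hmiss ω hω a haA (hthird a haA) hoa
  · -- Case A: the observer's blob carries a relay `x`
    obtain ⟨x, hx⟩ := Finset.card_pos.1 (Nat.pos_of_ne_zero h0)
    obtain ⟨hxA, hcx⟩ := Finset.mem_filter.1 hx
    obtain ⟨k, hki, hk⟩ := exists_heavy_blob A cls (cls o) (EN / 2) hT
    by_cases hmk : (A.filter fun a => cls a = k).card = 0
    · -- then `m_{cls o} ≥ EN/2` and the minority event is empty on `G`
      refine ⟨∅, fun ω hω => ?_, by rw [measureReal_empty]; exact ht⟩
      obtain ⟨-, hlt, hωG⟩ := memB ω hω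
      have hge := blobs_count_ge_self A o cls ω hωG
      have hge' : ((A.filter fun a => cls a = cls o).card : ℝ) ≤
          ((A.filter fun a => ω ∈ openConn o a).card : ℝ) := by exact_mod_cast hge
      have : ((A.filter fun a => cls a = k).card : ℝ) = 0 := by exact_mod_cast hmk
      rw [this, add_zero] at hk
      linarith
    · obtain ⟨y, hy⟩ := Finset.card_pos.1 (Nat.pos_of_ne_zero hmk)
      obtain ⟨hyA, hcy⟩ := Finset.mem_filter.1 hy
      have hxy : x ≠ y := fun h => hki (by rw [← hcy, ← h, hcx])
      refine ⟨(openConn x y)ᶜ, fun ω hω hxy' => ?_, hpair x hxA y hyA hxy⟩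
      obtain ⟨-, hlt, hωG⟩ := memB ω hω
      have hox : (openGraph ω).Reachable o x :=
        hωG o (Finset.mem_insert_self _ _) x (Finset.mem_insert_of_mem hxA) hcx.symm
      have hoy : (openGraph ω).Reachable o y := hox.trans hxy'
      have hge := blobs_count_ge A o cls ω hωG hyA hoy (by rw [hcy]; exact hki)
      have hge' : ((A.filter fun a => cls a = cls o).card : ℝ) +
          ((A.filter fun a => cls a = k).card : ℝ) ≤
            ((A.filter fun a => ω ∈ openConn o a).card : ℝ) := by
        rw [← hcy]; exact_mod_cast hge
      linarith

end Summit.CriticalPhenomena.PercolationContinuityZ3.Theorems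

end
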